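import Literature.NumberTheory.DiophantineGeometry.GenEllDeGoodPrimesOrd
import Literature.NumberTheory.DiophantineGeometry.GenEllGoodPrimeModulus
import Mathlib.RingTheory.DedekindDomain.IntegralClosure
import HarnessLib

/-!
# [GenEll] Thm. 2.1 on the `D_e` route: the finite set of bad primes `S_bad(e, B)` (plumbing for W9)

S. Mochizuki, *Arithmetic elliptic curves in general position*, Math. J. Okayama Univ. **52** (2010),
Prop. 1.6 p. 10 / proof of Thm. 2.1 pp. 12–13 [cite: MochizukiGenEll2010, Prop 1.6 p.10]; support
file for the route item `GenEllTwo` (stmt-ABC-19679), abc-iut-S6's `GENELLTWO-P1ROUTE.md` §3 (d),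
W5 coordinator abc-iut-w5-d045's RULING of 2026-08-26 (R-a′, INTERFACE CONTRACT (1)):

> `S_bad(e, B) : Finset ℕ` := the primes dividing `2·D(e, B)`, `D(e, B)` the good-reduction modulus of
> the fibre polynomials `{G_b}_{b ∈ B}`; it depends on `ε` only through `e = 2k+1` and on `φ = β∘t`
> only through `B`, never on the test field `L` or on the point `P`; and
> «`w ∉ placesOver S_bad` ⇒ every good-place hypothesis of `De.ord_placewise_of_gap` holds at `w`».

This file proves exactly that, packaged once:

* `valuation_natCast_eq_one_of_not_mem_biUnion` — a finite place `w` of a number field `L` outside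
  `⋃_{p ∣ D} placesOver L p` has `w(D) = 1`;
* `exists_modulus_valuation_le_one` / `exists_modulus_valuation_eq_one` — for a finite set `s` of
  elements (resp. nonzero elements) of a number field `K` there is `d > 0` such that, in EVERY number
  field `L ⊇ K` and at every finite place `w` with `w(d) = 1`, the elements of `s` are `w`-integral
  (resp. `w`-units);
* `De.exists_badPrimes` — for `k` and a finite `B ⊂ K` there is a finite set `S ∋ 2` of rational
  primes such that at every finite place `w` of every number field `L ⊇ K` NOT over `S`:
  `w(2) = 1`, every `b ∈ B` is `w`-integral, distinct `b, b′ ∈ B` have `w(b − b′) = 1`, and every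
  fibre polynomial `G_b` (`b ∈ B`) satisfies the multiplicity-gap conclusion `hgap` at `w`
  (from abc-iut-w5-d027's uniform modulus `GoodPrime.exists_modulus_val_aeval_lt_val_aeval_derivative_finset`);
* `De.hmeet_hoff_off_badPrimes` — the JUNCTION: with `Sbad := ⋃_{p ∈ S} placesOver L p` the two
  placewise inequalities `hmeet`/`hoff` of `FibreConductor.inv_finrank_mul_sum_logNorm_le_slope`
  (abc-iut-w5-d009) hold off `Sbad`, given only the curve/`t`/`N` normal forms, `t ∉ B` and the W5c
  converse `hconv` — i.e. `De.hmeet_hoff_of_gap` (abc-iut-w5-d045) with all four good-place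
  hypotheses discharged.

Theorems only; classical; nothing here bears on [IUTchIII] Cor. 3.12.
-/

noncomputable section

namespace Literature.NumberTheory.DiophantineGeometry.GenEll

open _root_.Polynomial NumberField IsDedekindDomain
open Literature.IUT.LogVolume

universe u

/-! ## Places off a rational modulus -/

section OffModulus

variable {L : Type u} [Field L] [NumberField L] (w : HeightOneSpectrum (𝓞 L))

/-- `ℤ`-integral elements of a number field are `w`-integral. [cite: MochizukiGenEll2010, Prop 1.6 p.10] -/
theorem valuation_le_one_of_isIntegral_int {x : L} (hx : IsIntegral ℤ x) : w.valuation L x ≤ 1 := by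
  have h := w.valuation_le_one (K := L) (⟨x, hx⟩ : 𝓞 L)
  simpa using h

/-- Natural numbers are `w`-integral. [cite: MochizukiGenEll2010, Prop 1.6 p.10] -/
theorem valuation_natCast_le_one (n : ℕ) : w.valuation L (n : L) ≤ 1 := by
  have h := valuation_le_one_of_isIntegral_int w
    (isIntegral_algebraMap (R := ℤ) (A := L) (x := (n : ℤ)))
  simpa using h

/-- If `w(D) = 1` and `d ∣ D` then `w(d) = 1`. [cite: MochizukiGenEll2010, Prop 1.6 p.10] -/
theorem valuation_natCast_eq_one_of_dvd {d D : ℕ} (hd : d ∣ D) (hD : w.valuation L (D : L) = 1) :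
    w.valuation L (d : L) = 1 := by
  obtain ⟨c, rfl⟩ := hd
  rw [Nat.cast_mul, map_mul] at hD
  refine le_antisymm (valuation_natCast_le_one w d) ?_
  calc (1 : _) = w.valuation L (d : L) * w.valuation L (c : L) := hD.symm
    _ ≤ w.valuation L (d : L) * 1 := mul_le_mul' le_rfl (valuation_natCast_le_one w c)
    _ = w.valuation L (d : L) := mul_one _

open scoped Classical in
/-- **Off the primes dividing `D`, `w(D) = 1`.** If the finite place `w` of `L` does not lie over any
prime factor of `D ≠ 0` then `D` is a `w`-unit (the residue characteristic `p_w` of `w` generates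
`w ∩ ℤ`, so `w(D) < 1` would give `p_w ∣ D`). [cite: MochizukiGenEll2010, Prop 1.6 p.10] -/
theorem valuation_natCast_eq_one_of_not_mem_biUnion {D : ℕ} (hD : D ≠ 0)
    (hw : w ∉ D.primeFactors.attach.biUnion fun p => placesOver L p.1) :
    w.valuation L (D : L) = 1 := by
  by_contra h
  have hlt : w.valuation L (D : L) < 1 := lt_of_le_of_ne (valuation_natCast_le_one w D) h
  have hmem : ((D : ℕ) : 𝓞 L) ∈ w.asIdeal := by
    rw [← HeightOneSpectrum.valuation_lt_one_iff_mem (K := L)]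
    simpa using hlt
  set p : ℕ := residueChar L w with hp
  haveI hpF : Fact p.Prime := ⟨residueChar_prime L w⟩
  have hunder : ((D : ℕ) : ℤ) ∈ w.asIdeal.under ℤ := by
    rw [Ideal.under_def, Ideal.mem_comap, map_natCast]
    exact hmem
  have hover : w.asIdeal.under ℤ = Ideal.span {(p : ℤ)} :=
    (Ideal.LiesOver.over (P := w.asIdeal) (p := Ideal.span {(p : ℤ)})).symm
  rw [hover, Ideal.mem_span_singleton] at hunder
  have hpD : p ∣ D := by exact_mod_cast hunder
  have hpmem : p ∈ D.primeFactors := Nat.mem_primeFactors.mpr ⟨hpF.out, hpD, hD⟩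
  exact hw (Finset.mem_biUnion.mpr ⟨⟨p, hpmem⟩, Finset.mem_attach _ _, mem_placesOver_residueChar w⟩)

end OffModulus

/-! ## Integrality and unit conditions for finitely many elements, uniformly in the test field -/

section Elements

variable {K : Type u} [Field K] [NumberField K]

/-- **Uniform integrality modulus.** For a finite set `s ⊂ K` there is `d > 0` such that in every
number field `L ⊇ K`, at every finite place `w` with `w(d) = 1`, all elements of `s` are `w`-integral
(`d` = a common denominator of `s` over `ℤ`). [cite: MochizukiGenEll2010, Prop 1.6 p.10] -/
theorem exists_modulus_valuation_le_one (s : Finset K) :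
    ∃ d : ℕ, 0 < d ∧ ∀ (L : Type u) [Field L] [NumberField L] [Algebra K L]
      (w : HeightOneSpectrum (𝓞 L)), w.valuation L (d : L) = 1 →
        ∀ x ∈ s, w.valuation L (algebraMap K L x) ≤ 1 := by
  obtain ⟨y, hy0, hy⟩ := exists_integral_multiples ℤ ℚ (L := K) s
  refine ⟨y.natAbs, Int.natAbs_pos.mpr hy0, fun L _ _ _ w hw x hx => ?_⟩
  have hint : IsIntegral ℤ (algebraMap K L (y • x)) := (hy x hx).map (algebraMap K L).toIntAlgHom
  have h1 : w.valuation L (algebraMap K L (y • x)) ≤ 1 := valuation_le_one_of_isIntegral_int w hint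
  have hyx : algebraMap K L (y • x) = (y : L) * algebraMap K L x := by
    rw [zsmul_eq_mul, map_mul, map_intCast]
  have hyv : w.valuation L (y : L) = 1 := by
    rcases Int.natAbs_eq y with h | h
    · have h' : (y : L) = (y.natAbs : L) := by
        have h'' := congrArg (Int.cast : ℤ → L) h
        rwa [Int.cast_natCast] at h''
      rw [h']; exact hw
    · have h' : (y : L) = -(y.natAbs : L) := by
        have h'' := congrArg (Int.cast : ℤ → L) h
        rwa [Int.cast_neg, Int.cast_natCast] at h''
      rw [h', Valuation.map_neg]; exact hw
  rw [hyx, map_mul, hyv, one_mul] at h1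
  exact h1

/-- **Uniform unit modulus.** For a finite set `s` of NONZERO elements of `K` there is `d > 0` such
that in every number field `L ⊇ K`, at every finite place `w` with `w(d) = 1`, all elements of `s` are
`w`-units. [cite: MochizukiGenEll2010, Prop 1.6 p.10] -/
theorem exists_modulus_valuation_eq_one (s : Finset K) (hs : ∀ x ∈ s, x ≠ 0) :
    ∃ d : ℕ, 0 < d ∧ ∀ (L : Type u) [Field L] [NumberField L] [Algebra K L]
      (w : HeightOneSpectrum (𝓞 L)), w.valuation L (d : L) = 1 →
        ∀ x ∈ s, w.valuation L (algebraMap K L x) = 1 := by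
  classical
  obtain ⟨d, hd0, hd⟩ := exists_modulus_valuation_le_one (s ∪ s.image fun x => x⁻¹)
  refine ⟨d, hd0, fun L _ _ _ w hw x hx => ?_⟩
  have h1 : w.valuation L (algebraMap K L x) ≤ 1 := hd L w hw x (Finset.mem_union_left _ hx)
  have h2 : w.valuation L (algebraMap K L x⁻¹) ≤ 1 :=
    hd L w hw _ (Finset.mem_union_right _ (Finset.mem_image_of_mem _ hx))
  have hx0 : algebraMap K L x ≠ 0 := (_root_.map_ne_zero (algebraMap K L)).mpr (hs x hx)
  have hprod : w.valuation L (algebraMap K L x) * w.valuation L (algebraMap K L x⁻¹) = 1 := by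
    rw [← map_mul, ← map_mul, mul_inv_cancel₀ (hs x hx), map_one, map_one]
  refine le_antisymm h1 ?_
  calc (1 : _) = w.valuation L (algebraMap K L x) * w.valuation L (algebraMap K L x⁻¹) := hprod.symm
    _ ≤ w.valuation L (algebraMap K L x) * 1 := mul_le_mul' le_rfl h2
    _ = w.valuation L (algebraMap K L x) := mul_one _

end Elements

/-! ## The bad primes of the fibre data `(e, B)` -/

/-- The fibre polynomial over `K` maps to the fibre polynomial over `L` under `algebraMap K L`.
[cite: MochizukiGenEll2010, Prop 1.6 p.10] -/
theorem De.map_fiber (k : ℕ) {K L : Type*} [Field K] [Field L] [Algebra K L] (b : K) {g : K[X]}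
    (hg : g = X ^ (2 * k + 4) + C (4 * b ^ 2) * X ^ (2 * k + 3) - C (8 * b) * X ^ (2 * k + 2)
      + C 4 * X ^ (2 * k + 1) - C (b ^ 2) * X ^ 2 + C (2 * b) * X - 1)
    {g' : L[X]}
    (hg' : g' = X ^ (2 * k + 4) + C (4 * (algebraMap K L b) ^ 2) * X ^ (2 * k + 3)
      - C (8 * algebraMap K L b) * X ^ (2 * k + 2) + C 4 * X ^ (2 * k + 1)
      - C ((algebraMap K L b) ^ 2) * X ^ 2 + C (2 * algebraMap K L b) * X - 1) :
    g.map (algebraMap K L) = g' := by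
  subst hg hg'
  simp [Polynomial.map_sub, Polynomial.map_add, Polynomial.map_mul, Polynomial.map_pow, map_ofNat]

section BadPrimes

variable {K : Type u} [Field K] [NumberField K]

open scoped Classical in
/-- **The bad primes `S_bad(e, B)`.** For `k` (`e = 2k+1`) and a finite set `B` in a number field `K`
there is a finite set `S ∋ 2` of rational primes — depending on nothing but `k`, `B` — such that for
every number field `L ⊇ K` and every finite place `w` of `L` not over `S`: `w(2) = 1`; every `b ∈ B`
is `w`-integral; distinct `b, b′ ∈ B` have `w(b − b′) = 1`; and for every `b ∈ B` the fibre polynomial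
`G_b` satisfies the multiplicity-gap conclusion at `w` (`ρ` `w`-integral, `0 < w(G_b ρ) < 1` ⇒
`w(G_b ρ) < w(G_b′ ρ)`; abc-iut-w5-d027's uniform good-reduction modulus). These are the four
good-place hypotheses of `De.ord_placewise_of_gap`. [cite: MochizukiGenEll2010, Prop 1.6 p.10] -/
theorem De.exists_badPrimes (k : ℕ) (B : Finset K) :
    ∃ S : Finset ℕ, 2 ∈ S ∧ (∀ p ∈ S, p.Prime) ∧
      ∀ (L : Type u) [Field L] [NumberField L] [Algebra K L] (w : HeightOneSpectrum (𝓞 L)),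
        w ∉ S.attach.biUnion (fun p => placesOver L p.1) →
        w.valuation L (2 : L) = 1 ∧
        (∀ b ∈ B, w.valuation L (algebraMap K L b) ≤ 1) ∧
        (∀ b ∈ B, ∀ b' ∈ B, b ≠ b' →
          w.valuation L (algebraMap K L b - algebraMap K L b') = 1) ∧
        (∀ b ∈ B, ∀ g : L[X],
          g = X ^ (2 * k + 4) + C (4 * (algebraMap K L b) ^ 2) * X ^ (2 * k + 3)
            - C (8 * algebraMap K L b) * X ^ (2 * k + 2) + C 4 * X ^ (2 * k + 1)
            - C ((algebraMap K L b) ^ 2) * X ^ 2 + C (2 * algebraMap K L b) * X - 1 →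
          ∀ ρ : L, w.valuation L ρ ≤ 1 → g.eval ρ ≠ 0 → w.valuation L (g.eval ρ) < 1 →
            w.valuation L (g.eval ρ) < w.valuation L ((derivative g).eval ρ)) := by
  classical
  -- (1) integrality of `B`
  obtain ⟨D₁, hD₁0, hD₁⟩ := exists_modulus_valuation_le_one (K := K) B
  -- (2) separation of `B`
  obtain ⟨D₂, hD₂0, hD₂⟩ := exists_modulus_valuation_eq_one (K := K)
    (((B ×ˢ B).image fun q => q.1 - q.2).filter fun x => x ≠ 0) (fun x hx => (Finset.mem_filter.mp hx).2)
  -- (3) good reduction of the fibre polynomials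
  let G : K → K[X] := fun b => X ^ (2 * k + 4) + C (4 * b ^ 2) * X ^ (2 * k + 3)
    - C (8 * b) * X ^ (2 * k + 2) + C 4 * X ^ (2 * k + 1) - C (b ^ 2) * X ^ 2 + C (2 * b) * X - 1
  have hG0 : ∀ b ∈ B, G b ≠ 0 := fun b _ => (De.fiber_monic k b (g := G b) rfl).ne_zero
  obtain ⟨D₃, hD₃0, hD₃⟩ :=
    GoodPrime.exists_modulus_val_aeval_lt_val_aeval_derivative_finset B G hG0
  -- the modulus and its prime factors
  set D : ℕ := 2 * D₁ * D₂ * D₃ with hDdef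
  have hD0 : D ≠ 0 := by positivity
  refine ⟨D.primeFactors, Nat.mem_primeFactors.mpr ⟨Nat.prime_two, ⟨D₁ * D₂ * D₃, by ring⟩, hD0⟩,
    fun p hp => Nat.prime_of_mem_primeFactors hp, fun L _ _ _ w hw => ?_⟩
  have hwD : w.valuation L (D : L) = 1 := valuation_natCast_eq_one_of_not_mem_biUnion w hD0 hw
  have hw2 : w.valuation L (2 : L) = 1 := by
    have h := valuation_natCast_eq_one_of_dvd w (⟨D₁ * D₂ * D₃, by ring⟩ : 2 ∣ D) hwD
    simpa using h
  have hw1 : w.valuation L (D₁ : L) = 1 :=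
    valuation_natCast_eq_one_of_dvd w (⟨2 * D₂ * D₃, by ring⟩ : D₁ ∣ D) hwD
  have hw2' : w.valuation L (D₂ : L) = 1 :=
    valuation_natCast_eq_one_of_dvd w (⟨2 * D₁ * D₃, by ring⟩ : D₂ ∣ D) hwD
  have hw3 : w.valuation L (D₃ : L) = 1 :=
    valuation_natCast_eq_one_of_dvd w (⟨2 * D₁ * D₂, by ring⟩ : D₃ ∣ D) hwD
  refine ⟨hw2, hD₁ L w hw1, fun b hb b' hb' hne => ?_, fun b hb g hg ρ hρ hg0 hlt => ?_⟩
  · have hmem : b - b' ∈ ((B ×ˢ B).image fun q => q.1 - q.2).filter fun x => x ≠ 0 :=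
      Finset.mem_filter.mpr ⟨Finset.mem_image.mpr ⟨(b, b'), Finset.mem_product.mpr ⟨hb, hb'⟩, rfl⟩,
        sub_ne_zero.mpr hne⟩
    have h := hD₂ L w hw2' (b - b') hmem
    rwa [map_sub] at h
  · have hmap : (G b).map (algebraMap K L) = g := De.map_fiber k b (g := G b) rfl hg
    have he : g.eval ρ = aeval ρ (G b) := by rw [← hmap, eval_map_algebraMap]
    have he' : (derivative g).eval ρ = aeval ρ (derivative (G b)) := by
      rw [← hmap, derivative_map, eval_map_algebraMap]
    rw [he] at hg0 hlt ⊢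
    rw [he']
    exact hD₃ b hb L w ρ hw3 hρ hg0 hlt

open scoped Classical in
/-- **JUNCTION: `hmeet`/`hoff` off the bad primes.** For `k` and `B ⊂ K` let `S = S_bad(e, B)` be as in
`De.exists_badPrimes`. Then for every number field `L ⊇ K`, every point datum `(r, s, t, N)` in `L` in
the normal forms of the `D_e` route (`s² = 1 − 4r^e`, `t·rs = s + r^{k+2}`,
`N = −s³ + (k+1)r^{k+2} − 2r^{3k+3}`, `N ≠ 0`, `t ∉ B`), every finite set `W` of places which off
`Sbad := ⋃_{p∈S} placesOver L p` is the meeting set `{w | ∃ b ∈ B, 0 < ord_w (t − b)}`, and given the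
converse `hconv` (package W5c) off `Sbad`, the placewise inequalities hold VERBATIM as the hypotheses
`hmeet`/`hoff` of `FibreConductor.inv_finrank_mul_sum_logNorm_le_slope` (with `B ↦ B.map (K → L)`):
on `W ∖ Sbad`, `1 + ord⁺_w N ≤ Σ_{b∈B} ord⁺_w (t − b)`; off `W ∪ Sbad`, `ord⁺_w N ≤ Σ_{b∈B} ord⁺_w (t − b)`.
[cite: MochizukiGenEll2010, Prop 1.6 p.10] -/
theorem De.hmeet_hoff_off_badPrimes (k : ℕ) (B : Finset K) :
    ∃ S : Finset ℕ, 2 ∈ S ∧ (∀ p ∈ S, p.Prime) ∧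
      ∀ (L : Type u) [Field L] [NumberField L] [Algebra K L] {r s t N : L},
        s ^ 2 = 1 - 4 * r ^ (2 * k + 1) → t * (r * s) = s + r ^ (k + 2) →
        N = -s ^ 3 + (k + 1) * r ^ (k + 2) - 2 * r ^ (3 * k + 3) → N ≠ 0 →
        (∀ b ∈ B, t ≠ algebraMap K L b) →
        ∀ W : Finset (HeightOneSpectrum (𝓞 L)),
        (∀ w : HeightOneSpectrum (𝓞 L), w ∉ S.attach.biUnion (fun p => placesOver L p.1) →
          w.valuation L N < 1 →
            ∃ b ∈ B.map ⟨algebraMap K L, (algebraMap K L).injective⟩, w.valuation L (t - b) < 1) →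
        (∀ w : HeightOneSpectrum (𝓞 L), w ∉ S.attach.biUnion (fun p => placesOver L p.1) →
          (w ∈ W ↔ ∃ b ∈ B.map ⟨algebraMap K L, (algebraMap K L).injective⟩, 0 < ord L w (t - b))) →
        (∀ w ∈ W, w ∉ S.attach.biUnion (fun p => placesOver L p.1) →
            1 + (ord L w N).toNat ≤
              ∑ b ∈ B.map ⟨algebraMap K L, (algebraMap K L).injective⟩, (ord L w (t - b)).toNat) ∧
        (∀ w, w ∉ W → w ∉ S.attach.biUnion (fun p => placesOver L p.1) →
            (ord L w N).toNat ≤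
              ∑ b ∈ B.map ⟨algebraMap K L, (algebraMap K L).injective⟩, (ord L w (t - b)).toNat) := by
  classical
  obtain ⟨S, h2S, hSp, hS⟩ := De.exists_badPrimes (K := K) k B
  refine ⟨S, h2S, hSp, ?_⟩
  intro L _ _ _ r s t N hcurve ht hN hN0 htB W hconv hW
  set ι : K ↪ L := ⟨algebraMap K L, (algebraMap K L).injective⟩ with hι
  set Sbad := S.attach.biUnion (fun p => placesOver L p.1) with hSbad
  have htB' : ∀ b ∈ B.map ι, t ≠ b := by
    intro b hb
    obtain ⟨b₀, hb₀, rfl⟩ := Finset.mem_map.mp hb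
    exact htB b₀ hb₀
  refine De.hmeet_hoff_of_gap k hcurve ht hN hN0 (B.map ι) htB'
    (fun c => X ^ (2 * k + 4) + C (4 * c ^ 2) * X ^ (2 * k + 3) - C (8 * c) * X ^ (2 * k + 2)
      + C 4 * X ^ (2 * k + 1) - C (c ^ 2) * X ^ 2 + C (2 * c) * X - 1)
    (fun _ _ => rfl) Sbad W ?_ ?_ ?_ ?_ hconv hW
  · intro w hw
    exact (hS L w hw).1
  · intro w hw b hb
    obtain ⟨b₀, hb₀, rfl⟩ := Finset.mem_map.mp hb
    exact (hS L w hw).2.1 b₀ hb₀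
  · intro w hw b hb b' hb' hne
    obtain ⟨b₀, hb₀, rfl⟩ := Finset.mem_map.mp hb
    obtain ⟨b₀', hb₀', rfl⟩ := Finset.mem_map.mp hb'
    have hne₀ : b₀ ≠ b₀' := fun h => hne (by rw [h])
    exact (hS L w hw).2.2.1 b₀ hb₀ b₀' hb₀' hne₀
  · intro w hw b hb ρ hρ hg0 hlt
    obtain ⟨b₀, hb₀, rfl⟩ := Finset.mem_map.mp hb
    exact (hS L w hw).2.2.2 b₀ hb₀ _ rfl ρ hρ hg0 hlt

open scoped Classical in
/-- **JUNCTION, enlargeable bad set.** As `De.hmeet_hoff_off_badPrimes`, but the consumer may ENLARGE the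
set of bad primes: for every finite `T ⊇ S_bad(e, B)` (e.g. `T = S_bad ∪ S_conv` with the exceptional
primes of the W5c converse `hconv`), with `Sbad := ⋃_{p∈T} placesOver L p`, the hypotheses `hconv`, `hW`
and the conclusions `hmeet`/`hoff` are all taken off `Sbad` — the shape W9 instantiates in
`FibreConductor.inv_finrank_mul_sum_logNorm_le_slope`. [cite: MochizukiGenEll2010, Prop 1.6 p.10] -/
theorem De.hmeet_hoff_off_badPrimes_of_subset (k : ℕ) (B : Finset K) :
    ∃ S : Finset ℕ, 2 ∈ S ∧ (∀ p ∈ S, p.Prime) ∧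
      ∀ (L : Type u) [Field L] [NumberField L] [Algebra K L] (T : Finset ℕ), S ⊆ T →
        ∀ {r s t N : L},
        s ^ 2 = 1 - 4 * r ^ (2 * k + 1) → t * (r * s) = s + r ^ (k + 2) →
        N = -s ^ 3 + (k + 1) * r ^ (k + 2) - 2 * r ^ (3 * k + 3) → N ≠ 0 →
        (∀ b ∈ B, t ≠ algebraMap K L b) →
        ∀ W : Finset (HeightOneSpectrum (𝓞 L)),
        (∀ w : HeightOneSpectrum (𝓞 L), w ∉ T.attach.biUnion (fun p => placesOver L p.1) →
          w.valuation L N < 1 →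
            ∃ b ∈ B.map ⟨algebraMap K L, (algebraMap K L).injective⟩, w.valuation L (t - b) < 1) →
        (∀ w : HeightOneSpectrum (𝓞 L), w ∉ T.attach.biUnion (fun p => placesOver L p.1) →
          (w ∈ W ↔ ∃ b ∈ B.map ⟨algebraMap K L, (algebraMap K L).injective⟩, 0 < ord L w (t - b))) →
        (∀ w ∈ W, w ∉ T.attach.biUnion (fun p => placesOver L p.1) →
            1 + (ord L w N).toNat ≤
              ∑ b ∈ B.map ⟨algebraMap K L, (algebraMap K L).injective⟩, (ord L w (t - b)).toNat) ∧
        (∀ w, w ∉ W → w ∉ T.attach.biUnion (fun p => placesOver L p.1) →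
            (ord L w N).toNat ≤
              ∑ b ∈ B.map ⟨algebraMap K L, (algebraMap K L).injective⟩, (ord L w (t - b)).toNat) := by
  classical
  obtain ⟨S, h2S, hSp, hS⟩ := De.exists_badPrimes (K := K) k B
  refine ⟨S, h2S, hSp, ?_⟩
  intro L _ _ _ T hST r s t N hcurve ht hN hN0 htB W hconv hW
  set ι : K ↪ L := ⟨algebraMap K L, (algebraMap K L).injective⟩ with hι
  set Sbad := T.attach.biUnion (fun p => placesOver L p.1) with hSbad
  -- off the larger union one is off the smaller one
  have hmono : ∀ w : HeightOneSpectrum (𝓞 L), w ∉ Sbad →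
      w ∉ S.attach.biUnion (fun p => placesOver L p.1) := by
    intro w hw hwS
    obtain ⟨p, -, hp⟩ := Finset.mem_biUnion.mp hwS
    exact hw (Finset.mem_biUnion.mpr ⟨⟨p.1, hST p.2⟩, Finset.mem_attach _ _, hp⟩)
  have htB' : ∀ b ∈ B.map ι, t ≠ b := by
    intro b hb
    obtain ⟨b₀, hb₀, rfl⟩ := Finset.mem_map.mp hb
    exact htB b₀ hb₀
  refine De.hmeet_hoff_of_gap k hcurve ht hN hN0 (B.map ι) htB'
    (fun c => X ^ (2 * k + 4) + C (4 * c ^ 2) * X ^ (2 * k + 3) - C (8 * c) * X ^ (2 * k + 2)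
      + C 4 * X ^ (2 * k + 1) - C (c ^ 2) * X ^ 2 + C (2 * c) * X - 1)
    (fun _ _ => rfl) Sbad W ?_ ?_ ?_ ?_ hconv hW
  · intro w hw
    exact (hS L w (hmono w hw)).1
  · intro w hw b hb
    obtain ⟨b₀, hb₀, rfl⟩ := Finset.mem_map.mp hb
    exact (hS L w (hmono w hw)).2.1 b₀ hb₀
  · intro w hw b hb b' hb' hne
    obtain ⟨b₀, hb₀, rfl⟩ := Finset.mem_map.mp hb
    obtain ⟨b₀', hb₀', rfl⟩ := Finset.mem_map.mp hb'
    have hne₀ : b₀ ≠ b₀' := fun h => hne (by rw [h])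
    exact (hS L w (hmono w hw)).2.2.1 b₀ hb₀ b₀' hb₀' hne₀
  · intro w hw b hb ρ hρ hg0 hlt
    obtain ⟨b₀, hb₀, rfl⟩ := Finset.mem_map.mp hb
    exact (hS L w (hmono w hw)).2.2.2 b₀ hb₀ _ rfl ρ hρ hg0 hlt

end BadPrimes

end Literature.NumberTheory.DiophantineGeometry.GenEll
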